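import Summits.Parity.GeneralizedHardyLittlewood.Theorems.BeyondDiagonalBeatsQuarter.OffDiagPrincipalCoprime
import Summits.Parity.GeneralizedHardyLittlewood.Theorems.BeyondDiagonalBeatsQuarter.OffDiagPrincipalShortBound
import HarnessLib

/-!
# Route `PrimeLevelFamEdge`, crux K_B (stmt-Parity-20343), line `diagonal_kernel_split` rev 4, plan Ω,
# OMEGA-BLUEPRINT v4 §3c / lead S l.7122 (2) — **the principal part PER SUBLATTICE: the coprime-restricted
# principal block term, summed against the mollifier, is a finite signed sum over the divisors `e ∣ n₀` with
# `n₀/e <` box height of SHORT-type lattice-sample sums of modulus `n₀/e`; each is bounded by the a8P-short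
# assembly (`OffDiagPrincipalShortBound`) with the two tools as hypotheses**

After prover-5's coprime restriction (`OffDiagPrincipalCoprime`, p650763: the `s`-sum of the principal parts runs
over `(s, h) = 1`, `h = h₁/g₀`, and equals `Σ_{e∣|h|} μ(e)·(|h|/e)·(complete lattice of step |h|/e)`), the object the
a8P bound must control at a dual modulus — short OR tall — is, for a finite set `P` of pairs `p = (l,m)` (with the
SAME reduced modulus `h`; the consumer groups the pairs by `g₀ = gcd(ab, h₁)`) with weights `w p`, box weights
`Φ p q` living on heights `(B₀, B)` and shifts `τ p q`:

* §1 `tsum_coprime_fourier2_intShift_eq_sum_filter_Icc` — one pair: only the divisors with `|h|/e < B` survive and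
  each sublattice sum is the FINITE sum over `k ∈ [1, N e]` (`B ≤ (|h|/e)(N e + 1)`; per-sublattice sample counts);
  `tsum_coprime_levelPrincipal_eq_sum_filter_Icc` — the same after the density factor and the level sum;
* §2 `sum_mul_tsum_coprime_levelPrincipal_eq` — pair weights outside, sublattices next, levels and samples inside:
  `Σ_p w p·Σ'_{(s,h)=1} levelPrincipal G (Φ̂_{p,·}) n = φ(n)⁻¹·Σ_{e∣|h|, |h|/e<B} μ(e)·((|h|/e)·Σ_{q unit} Σ_{k≤N e} S_e(q,k))`
  with the SUBLATTICE SAMPLE SUMS `S_e(q,k) = Σ_p w p·e(−τ_{p,q}(|h|/e)k)·𝓕(t₁ ↦ Φ_{p,q}(t₁,(|h|/e)k))(ξ₁ q)` — the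
  `e = 1` term is `OffDiagPrincipalShortBound` §1 (absent for a tall modulus `|h| ≥ B`);
* §3 `norm_density_sum_divisors_le_of_split` (generic) and **`norm_sum_mul_tsum_coprime_levelPrincipal_le_of_split`**:
  with W4/W3 AS HYPOTHESES per surviving sublattice (`‖S_e(q,k)‖ ≤ U₄ e q k` for `k ≤ K₀ e`,
  `Σ_{K₀ e<k≤N e} ‖S_e(q,k)‖ ≤ U₃ e q`):
  `‖Σ_p w p·Σ'_{(s,h)=1} levelPrincipal…‖ ≤ φ(n)⁻¹·Σ_{e∣|h|, |h|/e<B} (|h|/e)·Σ_{q unit}(Σ_{k≤K₀ e} U₄ e q k + U₃ e q)`;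
* §4 `fourierChar_sublattice_shift_eq_e_sign` — with `τ = A/(h·C)` the sublattice phase is
  `e(−τ(|h|/e)k) = e(σ·A·k/(e·C))`, `σ = −sgn h`: on the sublattice `e` the `k`-family has denominator `e·C`
  (numerator `A = ab/g₀`), so `OffDiagPrincipalShortBound` §3–§4 / `…ClosedForm` apply with `D = e·C`.

Identities + the split bound; the sizes `U₄, U₃` come from `MellinBumpPhase` / `OffDiagKFamilyLargeSieve` through
`OffDiagPrincipalShortBound(ClosedForm)`. Theorems only; standard axioms. Helper toward `stub_offDiagBelowSlack_io`;
closes nothing (the tall-moduli row is UNFUNDED beyond the closable regime — TRANSITION-SIZING §11).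
«The programme SEARCHES and TYPES; no claim about Landau–Siegel zeros, Theorems 1–2 of arXiv:2211.02515 or
a repaired Margin232 until a kernel theorem says so.»
-/

noncomputable section

open Real MeasureTheory Filter Complex Finset
open scoped FourierTransform Topology ContDiff ArithmeticFunction.Moebius

namespace Summit.Parity.GeneralizedHardyLittlewood.Theorems.BeyondDiagonalBeatsQuarter.OffDiag

open Literature.NumberTheory.Sieve.FriedlanderIwaniecPrimes (fourier2)
open Literature.NumberTheory.Sieve.LargeSieve (e e_eq_exp)

/-! ### §1. One pair: surviving divisors, finite sample ranges per sublattice -/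

section OnePair

variable {Φ : ℝ → ℝ → ℂ}

/-- **Coprime-restricted shifted-lattice sum, finite form per sublattice.** For `uncurry Φ` smooth of compact support
living on heights `(B₀, B)` (`0 ≤ B₀`), `h ≠ 0`, and per-divisor sample counts `N e` with `B ≤ (|h|/e)·(N e + 1)`:
`Σ'_{(s,h)=1} Φ̂(ξ₁, s/h + τ) = Σ_{e∣|h|, |h|/e<B} μ(e)·((|h|/e)·Σ_{k∈[1,N e]} e(−τ(|h|/e)k)·𝓕(t₁ ↦ Φ(t₁,(|h|/e)k))(ξ₁))`.
[folklore] -/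
theorem tsum_coprime_fourier2_intShift_eq_sum_filter_Icc (hΦ : ContDiff ℝ ∞ (Function.uncurry Φ))
    (hΦc : HasCompactSupport (Function.uncurry Φ)) {B₀ B : ℝ} (hB₀ : 0 ≤ B₀)
    (hsupp : ∀ t₁ t₂, Φ t₁ t₂ ≠ 0 → B₀ < t₂ ∧ t₂ < B) {h : ℤ} (hh : h ≠ 0) (N : ℕ → ℕ)
    (hN : ∀ e ∈ h.natAbs.divisors, B ≤ ((h.natAbs / e : ℕ) : ℝ) * (N e + 1)) (τ ξ₁ : ℝ) :
    ∑' s : ℤ, (if IsCoprime s h then fourier2 Φ ξ₁ ((s : ℝ) / h + τ) else 0) =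
      ∑ e ∈ h.natAbs.divisors.filter (fun e : ℕ ↦ ((h.natAbs / e : ℕ) : ℝ) < B), (μ e : ℂ) *
        (((h.natAbs / e : ℕ) : ℂ) * ∑ k ∈ Finset.Icc (1 : ℤ) (N e),
          (𝐞 (-(τ * ((h.natAbs / e : ℕ) * k))) : ℂ) * 𝓕 (fun t₁ : ℝ ↦ Φ t₁ ((h.natAbs / e : ℕ) * k)) ξ₁) := by
  rw [tsum_coprime_fourier2_intShift_eq_sum_filter hΦ hΦc hB₀ hsupp hh τ ξ₁]
  refine Finset.sum_congr rfl fun e he ↦ ?_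
  have he' : e ∈ h.natAbs.divisors := (Finset.mem_filter.1 he).1
  have hstep : 0 < h.natAbs / e :=
    Nat.div_pos (Nat.le_of_dvd (Int.natAbs_pos.mpr hh) (Nat.dvd_of_mem_divisors he'))
      (Nat.pos_of_mem_divisors he')
  rw [tsum_latticeSamples_eq_sum_Icc hB₀ hsupp hstep (hN e he')]

end OnePair

open Classical in
/-- **The coprime-restricted `s`-sum of the principal parts, finite form.** For a finite set of levels `G`, box
weights `Φ_q` (smooth, compact support, heights in `(B₀,B)`, `0 ≤ B₀`), `h ≠ 0`, sample counts `N e` with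
`B ≤ (|h|/e)(N e + 1)`, frequencies `ξ₁ q`, shifts `τ q` and bookkeeping modulus `n`:
`Σ'_{(s,h)=1} levelPrincipal G (q ↦ Φ̂_q(ξ₁ q, s/h + τ q)) n
   = φ(n)⁻¹·Σ_{q unit} Σ_{e∣|h|, |h|/e<B} μ(e)·((|h|/e)·Σ_{k∈[1,N e]} e(−τ_q(|h|/e)k)·𝓕(t₁ ↦ Φ_q(t₁,(|h|/e)k))(ξ₁ q))`.
[folklore] -/
theorem tsum_coprime_levelPrincipal_eq_sum_filter_Icc (G : Finset ℕ) (Φ : ℕ → ℝ → ℝ → ℂ)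
    (hΦ : ∀ q ∈ G, ContDiff ℝ ∞ (Function.uncurry (Φ q)))
    (hΦc : ∀ q ∈ G, HasCompactSupport (Function.uncurry (Φ q))) {B₀ B : ℝ} (hB₀ : 0 ≤ B₀)
    (hsupp : ∀ q ∈ G, ∀ t₁ t₂, Φ q t₁ t₂ ≠ 0 → B₀ < t₂ ∧ t₂ < B)
    {h : ℤ} (hh : h ≠ 0) (N : ℕ → ℕ) (hN : ∀ e ∈ h.natAbs.divisors, B ≤ ((h.natAbs / e : ℕ) : ℝ) * (N e + 1))
    (ξ₁ τ : ℕ → ℝ) (n : ℕ) :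
    ∑' s : ℤ, (if IsCoprime s h then
        levelPrincipal G (fun q ↦ fourier2 (Φ q) (ξ₁ q) ((s : ℝ) / h + τ q)) n else 0) =
      (Nat.totient n : ℂ)⁻¹ * ∑ q ∈ G.filter (fun q : ℕ ↦ IsUnit ((q : ℕ) : ZMod n)),
        ∑ e ∈ h.natAbs.divisors.filter (fun e : ℕ ↦ ((h.natAbs / e : ℕ) : ℝ) < B), (μ e : ℂ) *
          (((h.natAbs / e : ℕ) : ℂ) * ∑ k ∈ Finset.Icc (1 : ℤ) (N e),
            (𝐞 (-(τ q * ((h.natAbs / e : ℕ) * k))) : ℂ) *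
              𝓕 (fun t₁ : ℝ ↦ Φ q t₁ ((h.natAbs / e : ℕ) * k)) (ξ₁ q)) := by
  simp_rw [ite_levelPrincipal_eq]
  simp only [levelPrincipal, levelCoprimeSum]
  rw [tsum_mul_left]
  congr 1
  have hG' : ∀ q ∈ G.filter (fun q : ℕ ↦ IsUnit ((q : ℕ) : ZMod n)), q ∈ G :=
    fun q hq ↦ (Finset.mem_filter.mp hq).1
  rw [Summable.tsum_finsetSum]
  · refine Finset.sum_congr rfl fun q hq ↦ ?_
    exact tsum_coprime_fourier2_intShift_eq_sum_filter_Icc (hΦ q (hG' q hq)) (hΦc q (hG' q hq)) hB₀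
      (hsupp q (hG' q hq)) hh N hN (τ q) (ξ₁ q)
  · intro q hq
    refine ((summable_fourier2_intShift (hΦ q (hG' q hq)) (hΦc q (hG' q hq)) hh (τ q) (ξ₁ q)).indicator
      {s : ℤ | IsCoprime s h}).congr fun s ↦ ?_
    simp only [Set.indicator_apply, Set.mem_setOf_eq]

/-! ### §2. Pair weights outside, sublattices next, levels and samples inside -/

open Classical in
/-- **The coprime-restricted principal part summed against pair weights, per sublattice.** For a finite set `P` of
pairs (same reduced modulus `h ≠ 0`) with weights `w p`, box weights `Φ p q` (smooth, compact support, heights in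
`(B₀,B)`, `0 ≤ B₀`), shifts `τ p q`, frequencies `ξ₁ q`, sample counts `N e` (`B ≤ (|h|/e)(N e + 1)`), modulus `n`:
`Σ_p w p·Σ'_{(s,h)=1} levelPrincipal G (q ↦ Φ̂_{p,q}(ξ₁ q, s/h + τ p q)) n
   = φ(n)⁻¹·Σ_{e∣|h|, |h|/e<B} μ(e)·((|h|/e)·Σ_{q unit} Σ_{k∈[1,N e]} Σ_p w p·e(−τ_{p,q}(|h|/e)k)·𝓕(t₁ ↦ Φ_{p,q}(t₁,(|h|/e)k))(ξ₁ q))`.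
[folklore] -/
theorem sum_mul_tsum_coprime_levelPrincipal_eq {ι : Type*} (P : Finset ι) (w : ι → ℂ)
    (G : Finset ℕ) (Φ : ι → ℕ → ℝ → ℝ → ℂ)
    (hΦ : ∀ p ∈ P, ∀ q ∈ G, ContDiff ℝ ∞ (Function.uncurry (Φ p q)))
    (hΦc : ∀ p ∈ P, ∀ q ∈ G, HasCompactSupport (Function.uncurry (Φ p q))) {B₀ B : ℝ} (hB₀ : 0 ≤ B₀)
    (hsupp : ∀ p ∈ P, ∀ q ∈ G, ∀ t₁ t₂, Φ p q t₁ t₂ ≠ 0 → B₀ < t₂ ∧ t₂ < B)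
    {h : ℤ} (hh : h ≠ 0) (N : ℕ → ℕ) (hN : ∀ e ∈ h.natAbs.divisors, B ≤ ((h.natAbs / e : ℕ) : ℝ) * (N e + 1))
    (ξ₁ : ℕ → ℝ) (τ : ι → ℕ → ℝ) (n : ℕ) :
    ∑ p ∈ P, w p * ∑' s : ℤ, (if IsCoprime s h then
        levelPrincipal G (fun q ↦ fourier2 (Φ p q) (ξ₁ q) ((s : ℝ) / h + τ p q)) n else 0) =
      (Nat.totient n : ℂ)⁻¹ *
        ∑ e ∈ h.natAbs.divisors.filter (fun e : ℕ ↦ ((h.natAbs / e : ℕ) : ℝ) < B), (μ e : ℂ) *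
          (((h.natAbs / e : ℕ) : ℂ) * ∑ q ∈ G.filter (fun q : ℕ ↦ IsUnit ((q : ℕ) : ZMod n)),
            ∑ k ∈ Finset.Icc (1 : ℤ) (N e), ∑ p ∈ P, w p *
              ((𝐞 (-(τ p q * ((h.natAbs / e : ℕ) * k))) : ℂ) *
                𝓕 (fun t₁ : ℝ ↦ Φ p q t₁ ((h.natAbs / e : ℕ) * k)) (ξ₁ q))) := by
  -- per pair: §1, then pull the constants out and move the `p`-sum inside
  have hS : ∀ p ∈ P, w p * ∑' s : ℤ, (if IsCoprime s h then
      levelPrincipal G (fun q ↦ fourier2 (Φ p q) (ξ₁ q) ((s : ℝ) / h + τ p q)) n else 0) =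
      (Nat.totient n : ℂ)⁻¹ * ∑ e ∈ h.natAbs.divisors.filter (fun e : ℕ ↦ ((h.natAbs / e : ℕ) : ℝ) < B),
        (μ e : ℂ) * (((h.natAbs / e : ℕ) : ℂ) * ∑ q ∈ G.filter (fun q : ℕ ↦ IsUnit ((q : ℕ) : ZMod n)),
          ∑ k ∈ Finset.Icc (1 : ℤ) (N e), w p * ((𝐞 (-(τ p q * ((h.natAbs / e : ℕ) * k))) : ℂ) *
            𝓕 (fun t₁ : ℝ ↦ Φ p q t₁ ((h.natAbs / e : ℕ) * k)) (ξ₁ q))) := by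
    intro p hp
    rw [tsum_coprime_levelPrincipal_eq_sum_filter_Icc G (Φ p) (hΦ p hp) (hΦc p hp) hB₀ (hsupp p hp) hh N hN
      ξ₁ (τ p) n]
    simp only [Finset.mul_sum]
    rw [Finset.sum_comm]
    refine Finset.sum_congr rfl fun e _ ↦ Finset.sum_congr rfl fun q _ ↦ Finset.sum_congr rfl fun k _ ↦ ?_
    ring
  rw [Finset.sum_congr rfl hS, ← Finset.mul_sum]
  congr 1
  rw [Finset.sum_comm]
  refine Finset.sum_congr rfl fun e _ ↦ ?_
  rw [← Finset.mul_sum, ← Finset.mul_sum]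
  congr 2
  rw [Finset.sum_comm]
  refine Finset.sum_congr rfl fun q _ ↦ ?_
  rw [Finset.sum_comm]

/-! ### §3. The split bound per sublattice, the two tools as hypotheses -/

/-- **Signed divisor sums of density-weighted sample sums (generic).** For a finite set `E` of divisors with
coefficients `‖μ' e‖ ≤ 1`, steps `H e`, sample sums `S e q k` on `k ∈ [1, N e]`, split points `K₀ e ≤ N e`, and the
two bounds `‖S e q k‖ ≤ U₄ e q k` (`k ≤ K₀ e`) and `Σ_{K₀ e<k≤N e} ‖S e q k‖ ≤ U₃ e q`:
`‖φ⁻¹·Σ_{e∈E} μ' e·(H e·Σ_{q∈Q} Σ_{k∈[1,N e]} S e q k)‖ ≤ φ⁻¹·Σ_{e∈E} H e·Σ_{q∈Q} (Σ_{k≤K₀ e} U₄ e q k + U₃ e q)`.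
[folklore] -/
theorem norm_density_sum_divisors_le_of_split (E Q : Finset ℕ) (μ' : ℕ → ℂ) (hμ : ∀ e ∈ E, ‖μ' e‖ ≤ 1)
    (H : ℕ → ℕ) (S : ℕ → ℕ → ℤ → ℂ) (φ : ℕ) {K₀ N : ℕ → ℕ} (hK : ∀ e ∈ E, K₀ e ≤ N e)
    {U₄ : ℕ → ℕ → ℤ → ℝ} {U₃ : ℕ → ℕ → ℝ}
    (hW4 : ∀ e ∈ E, ∀ q ∈ Q, ∀ k ∈ Finset.Icc (1 : ℤ) (K₀ e), ‖S e q k‖ ≤ U₄ e q k)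
    (hW3 : ∀ e ∈ E, ∀ q ∈ Q, ∑ k ∈ Finset.Ioc (K₀ e : ℤ) (N e), ‖S e q k‖ ≤ U₃ e q) :
    ‖(φ : ℂ)⁻¹ * ∑ e ∈ E, μ' e * ((H e : ℂ) * ∑ q ∈ Q, ∑ k ∈ Finset.Icc (1 : ℤ) (N e), S e q k)‖ ≤
      (φ : ℝ)⁻¹ * ∑ e ∈ E, (H e * ∑ q ∈ Q, (∑ k ∈ Finset.Icc (1 : ℤ) (K₀ e), U₄ e q k + U₃ e q)) := by
  rw [norm_mul, norm_inv, Complex.norm_natCast]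
  refine mul_le_mul_of_nonneg_left ?_ (inv_nonneg.2 (Nat.cast_nonneg _))
  refine (norm_sum_le _ _).trans (Finset.sum_le_sum fun e he ↦ ?_)
  rw [norm_mul]
  have hin : ‖(H e : ℂ) * ∑ q ∈ Q, ∑ k ∈ Finset.Icc (1 : ℤ) (N e), S e q k‖ ≤
      H e * ∑ q ∈ Q, (∑ k ∈ Finset.Icc (1 : ℤ) (K₀ e), U₄ e q k + U₃ e q) := by
    rw [norm_mul, Complex.norm_natCast]
    refine mul_le_mul_of_nonneg_left ?_ (Nat.cast_nonneg _)
    refine (norm_sum_le _ _).trans (Finset.sum_le_sum fun q hq ↦ ?_)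
    refine (norm_sum_le _ _).trans ?_
    rw [sum_Icc_one_eq_add_sum_Ioc (fun k ↦ ‖S e q k‖) (hK e he)]
    exact add_le_add (Finset.sum_le_sum fun k hk ↦ hW4 e he q hq k hk) (hW3 e he q hq)
  calc ‖μ' e‖ * ‖(H e : ℂ) * ∑ q ∈ Q, ∑ k ∈ Finset.Icc (1 : ℤ) (N e), S e q k‖
      ≤ 1 * (H e * ∑ q ∈ Q, (∑ k ∈ Finset.Icc (1 : ℤ) (K₀ e), U₄ e q k + U₃ e q)) :=
        mul_le_mul (hμ e he) hin (norm_nonneg _) zero_le_one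
    _ = _ := one_mul _

open Classical in
/-- **The principal part per sublattice, bounded with the two tools as hypotheses.** In the setting of
`sum_mul_tsum_coprime_levelPrincipal_eq`, with the sublattice sample sums
`S_e(q,k) = Σ_p w p·e(−τ_{p,q}(|h|/e)k)·𝓕(t₁ ↦ Φ_{p,q}(t₁,(|h|/e)k))(ξ₁ q)`, split points `K₀ e ≤ N e` and, for every
SURVIVING divisor (`e ∣ |h|`, `|h|/e < B`) and unit level `q`: W4 `‖S_e(q,k)‖ ≤ U₄ e q k` (`k ≤ K₀ e`), W3
`Σ_{K₀ e<k≤N e} ‖S_e(q,k)‖ ≤ U₃ e q`: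
`‖Σ_p w p·Σ'_{(s,h)=1} levelPrincipal G (Φ̂_{p,·}) n‖ ≤ φ(n)⁻¹·Σ_{e∣|h|, |h|/e<B} (|h|/e)·Σ_{q unit}(Σ_{k≤K₀ e} U₄ e q k + U₃ e q)`.
[folklore] -/
theorem norm_sum_mul_tsum_coprime_levelPrincipal_le_of_split {ι : Type*} (P : Finset ι) (w : ι → ℂ)
    (G : Finset ℕ) (Φ : ι → ℕ → ℝ → ℝ → ℂ)
    (hΦ : ∀ p ∈ P, ∀ q ∈ G, ContDiff ℝ ∞ (Function.uncurry (Φ p q)))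
    (hΦc : ∀ p ∈ P, ∀ q ∈ G, HasCompactSupport (Function.uncurry (Φ p q))) {B₀ B : ℝ} (hB₀ : 0 ≤ B₀)
    (hsupp : ∀ p ∈ P, ∀ q ∈ G, ∀ t₁ t₂, Φ p q t₁ t₂ ≠ 0 → B₀ < t₂ ∧ t₂ < B)
    {h : ℤ} (hh : h ≠ 0) (N : ℕ → ℕ) (hN : ∀ e ∈ h.natAbs.divisors, B ≤ ((h.natAbs / e : ℕ) : ℝ) * (N e + 1))
    (ξ₁ : ℕ → ℝ) (τ : ι → ℕ → ℝ) (n : ℕ) {K₀ : ℕ → ℕ}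
    (hK : ∀ e ∈ h.natAbs.divisors.filter (fun e : ℕ ↦ ((h.natAbs / e : ℕ) : ℝ) < B), K₀ e ≤ N e)
    {U₄ : ℕ → ℕ → ℤ → ℝ} {U₃ : ℕ → ℕ → ℝ}
    (hW4 : ∀ e ∈ h.natAbs.divisors.filter (fun e : ℕ ↦ ((h.natAbs / e : ℕ) : ℝ) < B),
      ∀ q ∈ G.filter (fun q : ℕ ↦ IsUnit ((q : ℕ) : ZMod n)), ∀ k ∈ Finset.Icc (1 : ℤ) (K₀ e),
      ‖∑ p ∈ P, w p * ((𝐞 (-(τ p q * ((h.natAbs / e : ℕ) * k))) : ℂ) *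
        𝓕 (fun t₁ : ℝ ↦ Φ p q t₁ ((h.natAbs / e : ℕ) * k)) (ξ₁ q))‖ ≤ U₄ e q k)
    (hW3 : ∀ e ∈ h.natAbs.divisors.filter (fun e : ℕ ↦ ((h.natAbs / e : ℕ) : ℝ) < B),
      ∀ q ∈ G.filter (fun q : ℕ ↦ IsUnit ((q : ℕ) : ZMod n)), ∑ k ∈ Finset.Ioc (K₀ e : ℤ) (N e),
      ‖∑ p ∈ P, w p * ((𝐞 (-(τ p q * ((h.natAbs / e : ℕ) * k))) : ℂ) *
        𝓕 (fun t₁ : ℝ ↦ Φ p q t₁ ((h.natAbs / e : ℕ) * k)) (ξ₁ q))‖ ≤ U₃ e q) :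
    ‖∑ p ∈ P, w p * ∑' s : ℤ, (if IsCoprime s h then
        levelPrincipal G (fun q ↦ fourier2 (Φ p q) (ξ₁ q) ((s : ℝ) / h + τ p q)) n else 0)‖ ≤
      (Nat.totient n : ℝ)⁻¹ *
        ∑ e ∈ h.natAbs.divisors.filter (fun e : ℕ ↦ ((h.natAbs / e : ℕ) : ℝ) < B),
          ((h.natAbs / e : ℕ) * ∑ q ∈ G.filter (fun q : ℕ ↦ IsUnit ((q : ℕ) : ZMod n)),
            (∑ k ∈ Finset.Icc (1 : ℤ) (K₀ e), U₄ e q k + U₃ e q)) := by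
  rw [sum_mul_tsum_coprime_levelPrincipal_eq P w G Φ hΦ hΦc hB₀ hsupp hh N hN ξ₁ τ n]
  exact norm_density_sum_divisors_le_of_split _ _ (fun e ↦ (μ e : ℂ))
    (fun e _ ↦ by rw [Complex.norm_intCast]; exact_mod_cast ArithmeticFunction.abs_moebius_le_one)
    (fun e ↦ h.natAbs / e)
    (fun e q k ↦ ∑ p ∈ P, w p * ((𝐞 (-(τ p q * ((h.natAbs / e : ℕ) * k))) : ℂ) *
      𝓕 (fun t₁ : ℝ ↦ Φ p q t₁ ((h.natAbs / e : ℕ) * k)) (ξ₁ q))) _ hK hW4 hW3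

/-! ### §4. The sublattice phase in product form -/

/-- **The sublattice phase.** With the switched shift `τ = A/(h·C)` (`C ≠ 0`) and a divisor `e ∣ |h|`:
`A/(hC)·((|h|/e)·k) = sgn(h)·A·k/(e·C)` — on the sublattice `e` the `k`-family has denominator `e·C`. [folklore] -/
theorem sublattice_phase_shift_eq {h : ℤ} (hh : h ≠ 0) {C : ℝ} (hC : C ≠ 0) (A : ℝ) {e : ℕ}
    (he : e ∈ h.natAbs.divisors) (k : ℤ) :
    A / ((h : ℝ) * C) * (((h.natAbs / e : ℕ) : ℝ) * k) = (h.sign : ℝ) * A * k / (e * C) := by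
  have he0 : e ≠ 0 := (Nat.pos_of_mem_divisors he).ne'
  have he0R : (e : ℝ) ≠ 0 := by exact_mod_cast he0
  have hdvd : e ∣ h.natAbs := Nat.dvd_of_mem_divisors he
  have hcast : (((h.natAbs / e : ℕ) : ℝ)) = (h.natAbs : ℝ) / e := by
    rw [Nat.cast_div hdvd he0R]
  rw [hcast]
  have hh0 : (h : ℝ) ≠ 0 := by exact_mod_cast hh
  rcases lt_or_gt_of_ne hh with hneg | hpos
  · have habs : ((h.natAbs : ℕ) : ℝ) = -(h : ℝ) := by
      rw [Nat.cast_natAbs, abs_of_neg (by exact_mod_cast hneg), Int.cast_neg]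
    rw [habs, Int.sign_eq_neg_one_of_neg hneg]
    push_cast
    field_simp
  · have habs : ((h.natAbs : ℕ) : ℝ) = (h : ℝ) := by
      rw [Nat.cast_natAbs, abs_of_pos (by exact_mod_cast hpos)]
    rw [habs, Int.sign_eq_one_of_pos hpos]
    push_cast
    field_simp

/-- **The sublattice phase in `e`-form**: for `τ = ν/(h·C)` (`ν = A = ab/g₀ ∈ ℕ`, `C = q(r+1) ∈ ℕ`, `C ≠ 0`) and
`e ∣ |h|`: `𝐞(−(τ·((|h|/e)·k))) = e(σ·(ν·k/(e·C)))` with `σ = −sgn h = ±1` (`OffDiagPrincipalShortBound.neg_sign_eq_one_or`),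
so the sublattice-`e` sample sums are `k`-families of denominator `D = e·C`. [folklore] -/
theorem fourierChar_sublattice_shift_eq_e_sign {h : ℤ} (hh : h ≠ 0) {C : ℕ} (hC : C ≠ 0) (ν : ℕ) {e : ℕ}
    (he : e ∈ h.natAbs.divisors) (k : ℤ) :
    ((𝐞 (-((ν : ℝ) / ((h : ℝ) * C) * (((h.natAbs / e : ℕ) : ℝ) * k))) : ℂ)) =
      Literature.NumberTheory.Sieve.LargeSieve.e ((-(h.sign : ℝ)) * ((ν : ℝ) * k / ((e * C : ℕ) : ℝ))) := by
  have hC' : (C : ℝ) ≠ 0 := by exact_mod_cast hC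
  rw [sublattice_phase_shift_eq hh hC' (ν : ℝ) he k]
  show Literature.NumberTheory.Sieve.LargeSieve.e _ = Literature.NumberTheory.Sieve.LargeSieve.e _
  congr 1
  push_cast
  ring

end Summit.Parity.GeneralizedHardyLittlewood.Theorems.BeyondDiagonalBeatsQuarter.OffDiag
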